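import Summits.ValiantsHypothesis.ValiantsHypothesis.Theses.BarrierLever
import Literature.Computability.AlgebraicComplexity.VPDeterminantalQPProofs

/-!
# ValiantsHypothesis / BarrierLever — `DcSliceCoversVP`

Route `BarrierLever`, item `stmt-ValiantsHypothesis-8748` (support, rank 9):
`DefinableDcEquations → DefinableEquations` — the degree-`≤ n` determinantal slice
`{f : deg f ≤ n, dc f ≤ m n}` eventually swallows every `SmallCircuits ℂ n b`.

Proof: for `f` with `deg f ≤ n` and `L(f) ≤ n ^ b` put `E := max b 1 * (log₂ n + 1)`; then
`n < 2 ^ E`, `n ^ b ≤ 2 ^ E`, `1 ≤ E`, and the tree's single-polynomial bound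
`Literature.Computability.AlgebraicComplexity.determinantalComplexity_le_two_pow`
(Bürgisser–Clausen–Shokrollahi 1997, Thm. (21.36) with Thm. (21.27), via VSBR depth reduction)
gives `dc f ≤ 2 ^ (17 E²) = 2 ^ ((17 (max b 1)²) (log₂ n + 1)²)`, which is `≤ m n` eventually in
`n` by the growth clause of `DefinableDcEquations` taken at `C := 17 (max b 1)²`. Hence the same
level `a` and, for `n ≥ n₀ + n₁`, the same data `q, H` witness `DefinableEquations`.
-/

set_option linter.dupNamespace false

namespace Summit.ValiantsHypothesis.ValiantsHypothesis.Theorems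

open Literature.Computability.AlgebraicComplexity Literature.Barriers.ValiantsHypothesis

/-- The glue bound: an `n`-variate polynomial of degree `≤ n` and fan-in-two circuit size `≤ n ^ b`
has determinantal complexity `≤ 2 ^ (17 * (max b 1) ^ 2 * (Nat.log 2 n + 1) ^ 2)` — the bound
`determinantalComplexity_le_two_pow` (BCS 1997, Thm. (21.36)/(21.27)) at `d = n` and
`E = max b 1 * (Nat.log 2 n + 1)`, using `n < 2 ^ (Nat.log 2 n + 1)` and
`n ^ b ≤ 2 ^ (b * (Nat.log 2 n + 1))`. [folklore] -/
theorem determinantalComplexity_le_of_mem_smallCircuits {n b : ℕ} {f : MvPolynomial (Fin n) ℂ}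
    (hf : f ∈ SmallCircuits ℂ n b) :
    determinantalComplexity f ≤ 2 ^ (17 * max b 1 ^ 2 * (Nat.log 2 n + 1) ^ 2) := by
  obtain ⟨hdeg, hL⟩ := hf
  have hb1 : 1 ≤ max b 1 := le_max_right b 1
  have hn : n < 2 ^ (Nat.log 2 n + 1) := Nat.lt_pow_succ_log_self Nat.one_lt_two n
  have hE1 : 1 ≤ max b 1 * (Nat.log 2 n + 1) :=
    Nat.one_le_iff_ne_zero.2 (Nat.mul_ne_zero (by omega) (by omega))
  have hd : n < 2 ^ (max b 1 * (Nat.log 2 n + 1)) :=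
    hn.trans_le (Nat.pow_le_pow_right (by norm_num) (Nat.le_mul_of_pos_left _ (by omega)))
  have hc : complexity f ≤ 2 ^ (max b 1 * (Nat.log 2 n + 1)) :=
    calc complexity f ≤ n ^ b := hL
      _ ≤ (2 ^ (Nat.log 2 n + 1)) ^ b := Nat.pow_le_pow_left hn.le b
      _ = 2 ^ (b * (Nat.log 2 n + 1)) := by rw [← pow_mul, mul_comm]
      _ ≤ 2 ^ (max b 1 * (Nat.log 2 n + 1)) :=
          Nat.pow_le_pow_right (by norm_num) (Nat.mul_le_mul_right _ (le_max_left b 1))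
  calc determinantalComplexity f ≤ 2 ^ (17 * (max b 1 * (Nat.log 2 n + 1)) ^ 2) :=
        determinantalComplexity_le_two_pow hdeg hd hc hE1
    _ = 2 ^ (17 * max b 1 ^ 2 * (Nat.log 2 n + 1) ^ 2) := by rw [mul_pow, mul_assoc]

/-- Settles `stmt-ValiantsHypothesis-8748` (`DcSliceCoversVP`, route `BarrierLever`):
`DefinableDcEquations → DefinableEquations`. Given the threshold function `m` with its growth
clause and the level-`a` boolean-sum equations of the `dc ≤ m n` slice beyond `n₀`, the same `a`
works for `DefinableEquations`: for a size exponent `b` take `n₁` from the growth clause at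
`C = 17 * (max b 1) ^ 2`; for `n ≥ n₀ + n₁` every `f ∈ SmallCircuits ℂ n b` has `deg f ≤ n` and
`dc f ≤ 2 ^ (17 (max b 1)² (log₂ n + 1)²) ≤ m n` (`determinantalComplexity_le_of_mem_smallCircuits`),
so the slice equation `boolSum H` vanishes at `coeff f`. [folklore] -/
theorem dcSliceCoversVP_proof :
    Summit.ValiantsHypothesis.ValiantsHypothesis.Theses.BarrierLever.DcSliceCoversVP := by
  unfold Summit.ValiantsHypothesis.ValiantsHypothesis.Theses.BarrierLever.DcSliceCoversVP
    Summit.ValiantsHypothesis.ValiantsHypothesis.Theses.BarrierLever.DefinableDcEquations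
    Summit.ValiantsHypothesis.ValiantsHypothesis.Theses.BarrierLever.DefinableEquations
  rintro ⟨m, hgrowth, a, n₀, hdef⟩
  refine ⟨a, fun b => ?_⟩
  obtain ⟨n₁, hn₁⟩ := hgrowth (17 * max b 1 ^ 2)
  refine ⟨n₀ + n₁, fun n hn => ?_⟩
  obtain ⟨q, hq, H, hHc, hHd, hne, hvan⟩ := hdef n (by omega)
  refine ⟨q, hq, H, hHc, hHd, hne, fun f hf => hvan f hf.1 ?_⟩
  calc determinantalComplexity f ≤ 2 ^ (17 * max b 1 ^ 2 * (Nat.log 2 n + 1) ^ 2) :=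
        determinantalComplexity_le_of_mem_smallCircuits hf
    _ ≤ m n := hn₁ n (by omega)

end Summit.ValiantsHypothesis.ValiantsHypothesis.Theorems
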